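import Summits.HubbardSuperconductivity.HubbardSuperconductivity.Theorems.AnisotropyChordTransferGapInvV
import Summits.HubbardSuperconductivity.HubbardSuperconductivity.Theorems.AnisotropyChordTransferCompressibility

/-!
# Route `AnisotropyChord` / H0 rotor rung, route (1): PART N19 — CONJECTURE GM (ANISOTROPY GAP MONOTONICITY)
# (theory seat `hubbard-h0-rotor-theory-1`, generation 17, cycle 17, memo ROTOR-THEORY-17 §213; THEOREMS M51–M53;
# verbatim port of `cycle17/lean/PartN19.lean` by the prover seat `hubbard-h0-rotor-p1` g18 — PORT SPEC GM)

The residual of route (1) is a positive-density excitation LOWER bound (`SymmetricSectorGapInvV Δ C (k+1)`, i.e. the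
translation-invariant sector gap `≥ C/|V|`, OPEN PROBLEM).  This file types the cycle-17 COMPARISON hypothesis that would
supply it with `C = 2π² − ε` from the one point of the anisotropy line where the gap is a THEOREM:

* the sector Hamiltonian `H(Δ) = −Σ_b [½(S⁺S⁻ + h.c.) + Δ SᶻSᶻ]` restricted to `Sᶻ_tot = M` is `½ (Δ·Deg − Adj)` of the
  `n`-token graph of the torus (`n = L²/2 + M` particles) up to a constant: at `Δ = 1` it is `½·Laplacian` (the symmetric
  exclusion process), whose gap in EVERY sector is the one-particle gap `1 − cos(2π/L)` (Aldous' spectral-gap conjecture,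
  Caputo–Liggett–Richthammer 2010, Thm 1.1; token-graph form Dalfó–Duque–Fabila-Monroy–Fiol–Huemer–Trujillo-Negrete–Zaragoza
  2021) — `FerroSectorGapCLR` below (a NAMED FACT, used as a hypothesis);
* CONJECTURE GM: the full sector gap `γ_M(Δ, L)` is non-increasing in `Δ` on a window `[Δ₀, 1]` (`AnisotropyGapMonotone`), in
  particular `γ_M(Δ, L) ≥ γ_M(1, L)` (`GapDominatesFerro`, the endpoint form; Hellmann–Feynman: `dγ/dΔ = −(⟨P⟩₁ − ⟨P⟩₀)`,
  `P` = number of adjacent particle pairs, so GM says the first excited level has at least as many adjacent pairs as the ground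
  state).  Evidence: exact diagonalisation, kit jobs j324509/j324626 (4×4 all sectors, 5×5, 6×4, 6×6, 8×4, rings): no violation of
  the endpoint form for `Δ ≥ −0.8`; it FAILS for `Δ ≤ −0.9` at half filling (antiferromagnetic tower), hence the window.
* THEOREM (here, sorry-free): `GapDominatesFerro Δ₀ k ∧ FerroSectorGapCLR ⇒ SymmetricSectorGapInvV Δ C k` for every
  `Δ ∈ [Δ₀, 1]` and every `C < 2π²` (`L²(1 − cos(2π/L)) → 2π²`, via `Real.cos_bound`); with the tree chain
  (`condensateOnFirstSectors_of_gapInvV`) this gives BEC on the first `k` sectors as soon as the chain threshold is `< 2π²·c₀`.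
-/

set_option linter.dupNamespace false
set_option autoImplicit false

open Finset Filter Topology
open Literature.MathematicalPhysics.QuantumLattice Literature.Probability.LatticeModels
open Summit.HubbardSuperconductivity.HubbardSuperconductivity.Theorems.AnisotropyChord.InsertionEntropy
open Summit.HubbardSuperconductivity.HubbardSuperconductivity.Theorems.AnisotropyChord.Tower
open Summit.HubbardSuperconductivity.HubbardSuperconductivity.Theorems.AnisotropyChord

namespace Summit.HubbardSuperconductivity.HubbardSuperconductivity.Theorems.AnisotropyChord.Transfer

/-- sector-gap lower bounds are downward closed in the constant (`1 − ⟨a, φ⟩² ≥ 0` by Cauchy–Schwarz). [folklore] -/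
theorem sectorGapAtLeast_mono {L : ℕ} [NeZero L] {Δ M g g' : ℝ} (hg : g' ≤ g)
    (h : SectorGapAtLeast L Δ M g) : SectorGapAtLeast L Δ M g' := by
  intro a φ ha hφ hunit
  have h1 := h a φ ha hφ hunit
  have hfac : 0 ≤ 1 - (∑ σ, a σ * φ σ) ^ 2 := by
    have hcs := Finset.sum_mul_sq_le_sq_mul_sq (Finset.univ) a φ
    rw [ha.unit, hunit] at hcs
    linarith
  calc g' * (1 - (∑ σ, a σ * φ σ) ^ 2) ≤ g * (1 - (∑ σ, a σ * φ σ) ^ 2) :=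
        mul_le_mul_of_nonneg_right hg hfac
    _ ≤ energyQ L Δ φ - sectorE L Δ M := h1

/-- **CONJECTURE GM — anisotropy gap monotonicity (monotone form):** eventually in `L`, on the sectors `|j| ≤ k`, every
lower bound for the full sector gap of `H(Δ')` is one for `H(Δ)` whenever `Δ₀ ≤ Δ ≤ Δ' ≤ 1` (the gap is non-increasing in
the anisotropy on `[Δ₀, 1]`).  [conjecture: theory seat hubbard-h0-rotor-theory-1, cycle 17, memo §213; OPEN; numerically
verified on 4×4 (all sectors), 5×5, 6×4, 6×6, 8×4 for `Δ₀ = −0.4`; FALSE for `Δ₀ ≤ −0.9` (AF tower at half filling)] -/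
def AnisotropyGapMonotone (Δ₀ : ℝ) (k : ℕ) : Prop :=
  ∀ᶠ L : ℕ in atTop, ∀ [NeZero L], ∀ j : ℤ, |j| ≤ (k : ℤ) →
    ∀ Δ Δ' g : ℝ, Δ₀ ≤ Δ → Δ ≤ Δ' → Δ' ≤ 1 →
      SectorGapAtLeast L Δ' (j : ℝ) g → SectorGapAtLeast L Δ (j : ℝ) g

/-- **CONJECTURE GM — endpoint form (`γ_j(Δ) ≥ γ_j(1)`):** eventually in `L`, on the sectors `|j| ≤ k`, every lower bound for
the sector gap at the ferromagnetic point `Δ = 1` (where it is the SEP gap `1 − cos(2π/L)`, a theorem) is one at every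
`Δ ∈ [Δ₀, 1]`.  [conjecture: theory seat hubbard-h0-rotor-theory-1, cycle 17, memo §213; OPEN; no violation found for
`Δ₀ = −0.8` (kit j324509/j324626)] -/
def GapDominatesFerro (Δ₀ : ℝ) (k : ℕ) : Prop :=
  ∀ᶠ L : ℕ in atTop, ∀ [NeZero L], ∀ j : ℤ, |j| ≤ (k : ℤ) →
    ∀ Δ g : ℝ, Δ₀ ≤ Δ → Δ ≤ 1 →
      SectorGapAtLeast L 1 (j : ℝ) g → SectorGapAtLeast L Δ (j : ℝ) g

/-- the monotone form implies the endpoint form (`Δ' = 1`). [folklore] -/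
theorem gapDominatesFerro_of_monotone {Δ₀ : ℝ} {k : ℕ} (h : AnisotropyGapMonotone Δ₀ k) :
    GapDominatesFerro Δ₀ k := by
  filter_upwards [h] with L hL
  intro _ j hj Δ g h0 h1 hG
  exact hL j hj Δ 1 g h0 h1 le_rfl hG

/-- the endpoint form is monotone in the window. [folklore] -/
theorem gapDominatesFerro_mono {Δ₀ Δ₁ : ℝ} {k : ℕ} (h01 : Δ₀ ≤ Δ₁) (h : GapDominatesFerro Δ₀ k) :
    GapDominatesFerro Δ₁ k := by
  filter_upwards [h] with L hL
  intro _ j hj Δ g h0 h1 hG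
  exact hL j hj Δ g (le_trans h01 h0) h1 hG

/-- **NAMED FACT — the SEP gap in every particle-number sector (Aldous' conjecture / Caputo–Liggett–Richthammer):** at the
ferromagnetic point `Δ = 1` the sector Hamiltonian is `½·Laplacian` of the `n`-token graph of the torus `(ℤ/L)²`, whose
spectral gap equals the one-particle gap `1 − cos(2π/L)` in every sector.  Used here as a HYPOTHESIS, stated in the
tree's Temple-form sector-gap vocabulary (`SectorGapAtLeast`).  In print: Caputo–Liggett–Richthammer, J. AMS 23 (2010)
831–851, Thm 1.1 (interchange ⇒ exclusion by projection); Dalfó et al., Lin. Alg. Appl. 625 (2021) 322–348 (token-graph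
form); tree: `Literature.RepresentationTheory.FiniteGroups.AldousOrder.CaputoLiggettRichthammer_lambdaOne` (abstract form) —
the sector/Temple-form bridge (dictionary `H(1)|_n = ½·Laplacian` of the token graph, Perron amplitude = uniform) is NOT in
the tree.  [conjecture: theory seat hubbard-h0-rotor-theory-1, cycle 17, memo §213 — named hypothesis (published theorem +
untyped dictionary), not proved here] -/
def FerroSectorGapCLR : Prop :=
  ∀ L : ℕ, 3 ≤ L → ∀ [NeZero L], ∀ M : ℝ, SectorGapAtLeast L 1 M (1 - Real.cos (2 * Real.pi / (L : ℝ)))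

/-- `L² (1 − cos(2π/L)) ≥ 2π² − (5/6)π⁴/L²` for `L ≥ 7` (`Real.cos_bound` at `x = 2π/L ≤ 1`). [folklore] -/
theorem sq_mul_one_sub_cos_ge {L : ℕ} (hL : 7 ≤ L) :
    2 * Real.pi ^ 2 - 5 / 6 * Real.pi ^ 4 / (L : ℝ) ^ 2 ≤ (L : ℝ) ^ 2 * (1 - Real.cos (2 * Real.pi / (L : ℝ))) := by
  have hL7 : (7 : ℝ) ≤ (L : ℝ) := by exact_mod_cast hL
  have hLpos : (0 : ℝ) < (L : ℝ) := by linarith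
  set x : ℝ := 2 * Real.pi / (L : ℝ) with hx
  have hx0 : 0 ≤ x := by rw [hx]; positivity
  have hx1 : x ≤ 1 := by
    rw [hx, div_le_one hLpos]; linarith [Real.pi_lt_d2]
  have hb := Real.cos_bound (x := x) (by rw [abs_of_nonneg hx0]; exact hx1)
  rw [abs_of_nonneg hx0] at hb
  have hcos : Real.cos x ≤ 1 - x ^ 2 / 2 + x ^ 4 * (5 / 96) := by
    have := (abs_le.1 hb).2; linarith
  -- L² · x² = 4π²,  L² · x⁴ = 16 π⁴ / L²
  have e2 : (L : ℝ) ^ 2 * x ^ 2 = 4 * Real.pi ^ 2 := by rw [hx]; field_simp; ring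
  have e4 : (L : ℝ) ^ 2 * x ^ 4 = 16 * Real.pi ^ 4 / (L : ℝ) ^ 2 := by rw [hx]; field_simp; ring
  have hL2 : (0 : ℝ) ≤ (L : ℝ) ^ 2 := sq_nonneg _
  calc 2 * Real.pi ^ 2 - 5 / 6 * Real.pi ^ 4 / (L : ℝ) ^ 2
      = (L : ℝ) ^ 2 * (x ^ 2 / 2 - x ^ 4 * (5 / 96)) := by
        rw [mul_sub, show (L : ℝ) ^ 2 * (x ^ 2 / 2) = ((L : ℝ) ^ 2 * x ^ 2) / 2 by ring,
          show (L : ℝ) ^ 2 * (x ^ 4 * (5 / 96)) = ((L : ℝ) ^ 2 * x ^ 4) * (5 / 96) by ring, e2, e4]; ring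
    _ ≤ (L : ℝ) ^ 2 * (1 - Real.cos x) := by
        apply mul_le_mul_of_nonneg_left _ hL2; linarith

/-- eventually in `L`, `C ≤ L² (1 − cos(2π/L))` for every `C < 2π²`. [folklore] -/
theorem eventually_le_sq_mul_one_sub_cos {C : ℝ} (hC : C < 2 * Real.pi ^ 2) :
    ∀ᶠ L : ℕ in atTop, C ≤ (L : ℝ) ^ 2 * (1 - Real.cos (2 * Real.pi / (L : ℝ))) := by
  have hgap : 0 < 2 * Real.pi ^ 2 - C := by linarith
  -- choose L large enough that (5/6)π⁴/L² ≤ 2π² − C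
  have hT : ∀ᶠ L : ℕ in atTop, 5 / 6 * Real.pi ^ 4 / (2 * Real.pi ^ 2 - C) ≤ (L : ℝ) ^ 2 :=
    ((tendsto_pow_atTop two_ne_zero).comp tendsto_natCast_atTop_atTop).eventually_ge_atTop _
  filter_upwards [hT, eventually_ge_atTop 7] with L hLT hL7
  have hL7' : (7 : ℝ) ≤ (L : ℝ) := by exact_mod_cast hL7
  have hL2 : (0 : ℝ) < (L : ℝ) ^ 2 := by positivity
  have h1 := sq_mul_one_sub_cos_ge hL7
  have h2 : 5 / 6 * Real.pi ^ 4 / (L : ℝ) ^ 2 ≤ 2 * Real.pi ^ 2 - C := by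
    rw [div_le_iff₀ hL2]
    have := (div_le_iff₀ hgap).1 hLT
    linarith
  linarith

/-- **THEOREM (cycle 17): GM (endpoint form) + the SEP sector gap ⇒ the `1/|V|` symmetric gap with every constant `C < 2π²`.**
[conjecture: theory seat hubbard-h0-rotor-theory-1, cycle 17, memo §213 «GM ⇒ (H2-InvV) at C = 2π² − ε»; Lean proof here] -/
theorem symmetricSectorGapInvV_of_gapDominatesFerro {Δ₀ Δ C : ℝ} {k : ℕ} (h0 : Δ₀ ≤ Δ) (h1 : Δ ≤ 1)
    (hGM : GapDominatesFerro Δ₀ k) (hCLR : FerroSectorGapCLR) (hC : C < 2 * Real.pi ^ 2) :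
    SymmetricSectorGapInvV Δ C k := by
  unfold SymmetricSectorGapInvV
  filter_upwards [hGM, eventually_le_sq_mul_one_sub_cos hC, eventually_ge_atTop 3] with L hL hcos hL3
  intro _ j hj a φ ha hφ _ hunit
  have hcard : (Fintype.card (TorusSite 2 L) : ℝ) = (L : ℝ) ^ 2 := by
    rw [Fintype.card_fun, ZMod.card, Fintype.card_fin]; push_cast; ring
  have hL3' : (3 : ℝ) ≤ (L : ℝ) := by exact_mod_cast hL3
  have hL2 : (0 : ℝ) < (L : ℝ) ^ 2 := by positivity
  have hferro : SectorGapAtLeast L 1 (j : ℝ) (1 - Real.cos (2 * Real.pi / (L : ℝ))) := hCLR L hL3 (j : ℝ)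
  have hΔ : SectorGapAtLeast L Δ (j : ℝ) (1 - Real.cos (2 * Real.pi / (L : ℝ))) := hL j hj Δ _ h0 h1 hferro
  have hg : C / (L : ℝ) ^ 2 ≤ 1 - Real.cos (2 * Real.pi / (L : ℝ)) := by
    rw [div_le_iff₀ hL2]; linarith
  rw [hcard]
  exact sectorGapAtLeast_mono hg hΔ a φ ha hφ hunit

/-- the same from the monotone form. [folklore] -/
theorem symmetricSectorGapInvV_of_anisotropyGapMonotone {Δ₀ Δ C : ℝ} {k : ℕ} (h0 : Δ₀ ≤ Δ) (h1 : Δ ≤ 1)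
    (hGM : AnisotropyGapMonotone Δ₀ k) (hCLR : FerroSectorGapCLR) (hC : C < 2 * Real.pi ^ 2) :
    SymmetricSectorGapInvV Δ C k :=
  symmetricSectorGapInvV_of_gapDominatesFerro h0 h1 (gapDominatesFerro_of_monotone hGM) hCLR hC

/-- **COROLLARY (BEC from GM):** `0 ≤ Δ < 1`, anchor `c₀`, GM on `[Δ₀, 1] ∋ Δ` for the sectors `|j| ≤ k+1`, the SEP sector gap, and
the chain threshold `2(k+1)·Σ_{i≤k} D_i(1−Δ, c₀/4) < 2π²·c₀` ⇒ `CondensateOnFirstSectors Δ k`.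
[conjecture: theory seat hubbard-h0-rotor-theory-1, cycle 17, memo §213; Lean proof here] -/
theorem condensateOnFirstSectors_of_gapDominatesFerro {Δ₀ Δ c₀ : ℝ} {k : ℕ} (hΔ₀ : Δ₀ ≤ Δ) (hΔ0 : 0 ≤ Δ) (hΔ1 : Δ < 1)
    (hc₀ : 0 < c₀) (hA : HalfFillingAnchor Δ c₀) (hGM : GapDominatesFerro Δ₀ (k + 1)) (hCLR : FerroSectorGapCLR)
    (hsmall : 2 * ((k : ℝ) + 1) * (∑ i ∈ range (k + 1), dSeq (1 - Δ) (c₀ / 4) i) < 2 * Real.pi ^ 2 * c₀) :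
    CondensateOnFirstSectors Δ k := by
  set D : ℝ := 2 * ((k : ℝ) + 1) * (∑ i ∈ range (k + 1), dSeq (1 - Δ) (c₀ / 4) i) with hD
  have hD0 : 0 ≤ D := by
    rw [hD]; exact mul_nonneg (by positivity) (Finset.sum_nonneg fun i _ => dSeq_nonneg (by linarith) (by positivity) i)
  -- a constant C strictly between D/c₀ and 2π²
  set C : ℝ := (D / c₀ + 2 * Real.pi ^ 2) / 2 with hCdef
  have hDc : D / c₀ < 2 * Real.pi ^ 2 := by rw [div_lt_iff₀ hc₀]; linarith
  have hC2 : C < 2 * Real.pi ^ 2 := by rw [hCdef]; linarith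
  have hC1 : D / c₀ < C := by rw [hCdef]; linarith
  have hCpos : 0 < C := lt_of_le_of_lt (by positivity) hC1
  have hGap : SymmetricSectorGapInvV Δ C (k + 1) :=
    symmetricSectorGapInvV_of_gapDominatesFerro hΔ₀ hΔ1.le hGM hCLR hC2
  refine condensateOnFirstSectors_of_gapInvV hΔ0 hΔ1 hc₀ hCpos hA hGap ?_
  rw [← hD]
  have := (div_lt_iff₀ hc₀).1 hC1
  linarith

end Summit.HubbardSuperconductivity.HubbardSuperconductivity.Theorems.AnisotropyChord.Transfer
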